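import Summits.BirchSwinnertonDyer.BirchSwinnertonDyer.Theorems.ThetaPartnerAtTwoSignedKatoUpToAtTwoOfPubKatoOnly
import Literature.NumberTheory.EllipticCurves.KatoTwistedSelmerFinitenessTrivialCharacterProofs
import HarnessLib

/-!
# Route `ThetaPartnerAtTwo` (TP2) / `ResidualThetaTransportAtTwo` (RTT), crux K3 `SignedKatoDivisibilityUpToAtTwo`
# (stmt-BirchSwinnertonDyer-20308), line `colemanrat` v16 — the Kato-only certificate over the GZK socket READ AT THE
# APEX of the tree's Kato-finiteness lattice: K3 BY NAME ⟸ {Kato Thm. 13.4 (2) at `2`, Kato Cor. 14.3 (1) over `ℚ(ζ_m)`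
# (`kato_finite_chiPart_selmer_of_twistedLValue_ne_zero`, every `p`), Kato Thm. 12.5 (1)-package at `2`}

Width seat `bsd-wall-tp2-p2x-w3` g10 (cell `bsd-wall`). Appendix to `…OfPubKatoOnly` (the socket certificates: K3 ⟸
{13.4 (2)@2-contra, (RK⁺), fact}, and the Kato-only readings through bsd.S20 / `Kato2004.thm12_4`). HONEST FRAMING:
COMPOSITIONS ONLY — no definition, no named fact, no instance, no `sorry`; CONDITIONAL theorems displaying three EXISTING
named Literature facts, none proved in the tree; nothing is closed; K3 / K3P′ are NOT settled; BSD is NOT proved by this.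

## Why this reading

In the tree bsd.S20 `kato_finite_of_L_one_ne_zero` (Kato Cor. 14.3 at `K = ℚ`, `χ = 1`) is itself CLOSED MODULO the apex fact
`kato_finite_chiPart_selmer_of_twistedLValue_ne_zero` (Kato Cor. 14.3 (1) over `ℚ(ζ_m)`, `m ≢ 2 (4)`, every prime `p`) for every
elliptic `E/ℚ` with a newform (`finite_selmerGroupPInfty_of_kato_finite_chiPart_selmer`,
`kato_finite_of_L_one_ne_zero_of_kato_finite_chiPart_selmer`, file `KatoTwistedSelmerFinitenessTrivialCharacterProofs`). On K3's
habitat the newform `f` of `W` is a binder, so the Selmer clause the socket needs (`Sel_{2^∞}(E/ℚ)` finite at `L(E,1) ≠ 0`) is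
available from the apex fact directly: `IsNewformOf W f` ⇒ `L(E, s)` entire (`hasEntireLFunction_of_cuspCoeff_eq`) ⇒
`r_an = 0 ⇔ L(E, 1) ≠ 0` (`analyticRank_eq_zero_iff_holds`) ⇒ `Sel_{2^∞}(E/ℚ)` finite
(`finite_selmerGroupPInfty_of_kato_finite_chiPart_selmer`, `m = 1`, `χ = 𝟙`, descent with finite kernel) ⇒ (RK⁺)
(`rank_iwasawaH1_le_one_of_finite_selmerGroupPInfty`: Kato 14.5 (1)/14.13 ⇒ (R0) ⇒ 12.4 (2) upper half). So K3 hangs on the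
SAME Kato fact as every other rank-zero Kato consumer of the family (the apex of the lattice), not on a K3-specific spelling.

## What is proved

* `signedKatoDivisibilityUpToAtTwo_of_kato2004_apex_facts` — **K3 ⟸ {`Kato2004.thm13_4_two_lengthAt_fineSelmerDualContra_le_of_isEulerSystemClassTwo`,
  `kato_finite_chiPart_selmer_of_twistedLValue_ne_zero`, `Kato2004.exists_eulerSystem_expStar_tatePairing_values_two`}** — three
  named theorems of Kato, Astérisque 295 (Thm. 13.4 (2); Cor. 14.3 (1); Thm. 12.5 (1) with (8.1.3)/Ex. 13.3 read on the layer Tate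
  pairing), no Gross–Zagier, no Kolyvagin; `…_rtt_…` the same on the RTT decl.

References: [Kato2004Asterisque] Thm. 12.5 (1) (pp. 221–222), Thm. 13.4 (2) (p. 226), Thm. 14.2 (2) and Cor. 14.3 (1) (p. 235),
Thm. 14.5 (1) (p. 236); [DokchitserDokchitser2010] Lemma 4.14 (descent with finite kernel); [BirchSwinnertonDyer1965].
-/

set_option autoImplicit false
-- the Theorems namespace of this sub repeats the summit name by design (D-0017 nested layout)
set_option linter.dupNamespace false

noncomputable section

set_option backward.isDefEq.respectTransparency false

open scoped Classical MatrixGroups ModularForm NumberField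

open CongruenceSubgroup WeierstrassCurve Field IsDedekindDomain NumberField
  Literature.NumberTheory.GaloisRepresentations
  Literature.NumberTheory.EllipticCurves Literature.NumberTheory.EllipticCurves.ModularForms
  Literature.NumberTheory.EllipticCurves.Module Literature.NumberTheory.EllipticCurves.Rank1Residual
  Literature.NumberTheory.EllipticCurves.Kobayashi2003 Literature.NumberTheory.EllipticCurves.Kato2004
  Literature.NumberTheory.EllipticCurves.Kato2004.EulerSystemValues Literature.NumberTheory.EllipticCurves.GreenbergSelmer
  ZpExtension Summit.BirchSwinnertonDyer.Rank1Residual.Supersingular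

namespace Summit.BirchSwinnertonDyer.BirchSwinnertonDyer.Theorems.SignedKatoOffTwo.KatoBK

/-- **K3 (TP2 decl `SignedKatoDivisibilityUpToAtTwo`, item stmt-BirchSwinnertonDyer-20308) BY NAME ⟸ THREE NAMED THEOREMS OF KATO,
Astérisque 295, read at the APEX of the tree's Kato-finiteness lattice:** Thm. 13.4 (2) at `p = 2`
(`Kato2004.thm13_4_two_lengthAt_fineSelmerDualContra_le_of_isEulerSystemClassTwo`), Cor. 14.3 (1) of Thm. 14.2 (2) over `ℚ(ζ_m)` for
every prime (`kato_finite_chiPart_selmer_of_twistedLValue_ne_zero`: `L_{prime(m)}(f, χ, 1) ≠ 0 ⇒ Sel_{p^∞}(E/ℚ(ζ_m))^(χ)` finite), and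
Thm. 12.5 (1) with (8.1.3)/Ex. 13.3 read on the layer Tate pairing at `2` (`Kato2004.exists_eulerSystem_expStar_tatePairing_values_two`).
Road: the socket master certificate `signedKatoDivisibilityUpToAtTwo_of_contraFact_of_rankLeOneNewform_of_kato_tatePairing_fact` fed, per
habitat curve `W` with newform `f`, by `L(E, s)` entire (`hasEntireLFunction_of_cuspCoeff_eq`), `r_an(W) = 0 ⇒ L(E, 1) ≠ 0`
(`analyticRank_eq_zero_iff_holds`), `Sel_{2^∞}(W/ℚ)` finite (`finite_selmerGroupPInfty_of_kato_finite_chiPart_selmer`: `m = 1`, `χ = 𝟙`,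
descent), and `rank_iwasawaH1_le_one_of_finite_selmerGroupPInfty`. No Gross–Zagier, no Kolyvagin, no new Literature fact. CONDITIONAL on
the three displayed facts (none proved in the tree); closes nothing by itself; BSD is not proved by this.
[cite: Kato2004Asterisque, Thm. 12.5 (1) (pp. 221–222), Thm. 13.4 (2) (p. 226), Cor. 14.3 (1) (p. 235), Thm. 14.5 (1) (p. 236)]
[cite: DokchitserDokchitser2010, Lemma 4.14] [cite: Kobayashi2003, Thm. 6.3 (p. 11), Prop. 8.25] [cite: Rubin1998Durham, Thm. 7.1] -/
theorem signedKatoDivisibilityUpToAtTwo_of_kato2004_apex_facts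
    (hK2 : Kato2004.thm13_4_two_lengthAt_fineSelmerDualContra_le_of_isEulerSystemClassTwo)
    (h143 : kato_finite_chiPart_selmer_of_twistedLValue_ne_zero)
    (hF : Kato2004.exists_eulerSystem_expStar_tatePairing_values_two) :
    Summit.BirchSwinnertonDyer.BirchSwinnertonDyer.Theses.ThetaPartnerAtTwo.SignedKatoDivisibilityUpToAtTwo :=
  signedKatoDivisibilityUpToAtTwo_of_contraFact_of_rankLeOneNewform_of_kato_tatePairing_fact hK2
    (fun W _ _ _ hr _ _ _ _ _ hκ hγ _ f hf I ↦ by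
      have hE : W.HasEntireLFunction := W.hasEntireLFunction_of_cuspCoeff_eq (strictWidthInfty_Gamma0 _) f hf.2
      have hL : W.entireLFunction 1 ≠ 0 := (WeierstrassCurve.analyticRank_eq_zero_iff_holds (W := W) hE).mp hr
      haveI : Finite (W.selmerGroupPInfty 2) := finite_selmerGroupPInfty_of_kato_finite_chiPart_selmer h143 W hf hL 2
      exact rank_iwasawaH1_le_one_of_finite_selmerGroupPInfty hκ hγ I) hF

/-- RTT reading of `signedKatoDivisibilityUpToAtTwo_of_kato2004_apex_facts` (byte-identical body of the route decl): K3 (RTT decl) ⟸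
{Kato 13.4 (2)@2, Kato Cor. 14.3 (1) over `ℚ(ζ_m)`, Kato 12.5-package}, no Gross–Zagier–Kolyvagin. CONDITIONAL; closes nothing by
itself; BSD is not proved by this. [cite: Kato2004Asterisque, Thm. 13.4 (2) (p. 226), Cor. 14.3 (1) (p. 235), Thm. 12.5 (1) (pp. 221–222)] -/
theorem signedKatoDivisibilityUpToAtTwo_rtt_of_kato2004_apex_facts
    (hK2 : Kato2004.thm13_4_two_lengthAt_fineSelmerDualContra_le_of_isEulerSystemClassTwo)
    (h143 : kato_finite_chiPart_selmer_of_twistedLValue_ne_zero)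
    (hF : Kato2004.exists_eulerSystem_expStar_tatePairing_values_two) :
    Summit.BirchSwinnertonDyer.BirchSwinnertonDyer.Theses.ResidualThetaTransportAtTwo.SignedKatoDivisibilityUpToAtTwo :=
  signedKatoDivisibilityUpToAtTwo_of_kato2004_apex_facts hK2 h143 hF

end Summit.BirchSwinnertonDyer.BirchSwinnertonDyer.Theorems.SignedKatoOffTwo.KatoBK

end
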